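import Summits.Ventures.PercRepro2.CaseOneLeafDelete
import Summits.Ventures.PercRepro2.CaseOneRootsOnlyQ
import Summits.Ventures.PercRepro2.CaseOneRootsAndOQ

/-!
# `(i)`, `(ii)` and `(J1₁)` for `a₃` pendant at a root-only or a roots-and-`o` vertex
(blind cell PercRepro2, p1 g19; the pendant lemma K8 closed at the two D-world classes)

The pendant lemma (K8, `zSplitII_of_leaf_at` / `zSplitI_of_leaf_at`) reads
`(ii)(a₃) = w · [(1 − w) · (ii-Q)(u) + w · (ii)(u)]` (likewise `(i)`) for `a₃` a leaf at `u` with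
edge weight `w`. At a vertex `u` whose other edges all join the roots (`CaseOneRootsOnly` /
`CaseOneRootsOnlyI` / `CaseOneRootsOnlyQ`), or join the roots and `o` (`CaseOneRootsAndMark` /
`CaseOneRootsAndOI` / `CaseOneRootsAndOQ`), all four brackets are theorems in `G − e₀`, whence in
`G` by the leaf-deletion transfer (`CaseOneLeafDelete`). So **`zSplitII_of_leaf_rootsOnly`**,
**`zSplitI_of_leaf_rootsOnly`**, **`jOneOne_of_leaf_rootsOnly`** and
**`zSplitII_of_leaf_rootsAndO`**, **`zSplitI_of_leaf_rootsAndO`**, **`jOneOne_of_leaf_rootsAndO`**: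
`(ii)`, `(i)` and `(J1₁)` for every
finite graph, every weight vector and every `a₃` of degree one whose neighbour `u` is adjacent only
to the roots (any multiplicities), resp. to the roots and `o` (one `o`-edge, any root
multiplicities); the descriptions of the two classes in `G` itself are in
`CaseOneRootsAndOPendantG.lean`. Own code; standard axioms.
-/

namespace Summit.Ventures.PercRepro2

namespace CaseOne

section Pendant
variable {V : Type*} {E : Type*} [Fintype E] [DecidableEq E] [Fintype V] [DecidableEq V]
  {R : Type*} [Field R] [LinearOrder R] [IsStrictOrderedRing R]
variable {ends : E → Sym2 V} {o a₁ a₂ b u a₃ : V} {e₀ : E}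

/-- **`(ii)` for `a₃` pendant at a root-only vertex**: `a₃` is a leaf at `u` (edge `e₀`), and in
`G − e₀` every edge at `u` joins a root; every weight vector. -/
theorem zSplitII_of_leaf_rootsOnly (p : E → R) (hp : IsProbVec p) (hl : IsLeafAt ends u a₃ e₀)
    (ho : o ≠ a₃) (h1 : a₁ ≠ a₃) (h2 : a₂ ≠ a₃) (hb : b ≠ a₃)
    (hroot : ∀ e : {e : E // e ≠ e₀}, u ∈ restrictEnds ends e₀ e →
      restrictEnds ends e₀ e = s(a₁, u) ∨ restrictEnds ends e₀ e = s(a₂, u)) (hu1 : a₁ ≠ u) :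
    ZSplitII p ends o a₁ a₂ a₃ b :=
  zSplitII_of_leaf_at p hp hl o a₁ a₂ b ho h1 h2 hb
    (zSplitII_of_restrict p hl ho h1 h2 hl.ne hb
      (zSplitII_of_rootsOnly (restrictW p e₀) (IsProbVec.restrictW hp e₀) hroot hu1 o b))
    (zSplitIIQ_of_restrict p hl ho h1 h2 hl.ne hb
      (zSplitIIQ_of_rootsOnly (restrictW p e₀) (IsProbVec.restrictW hp e₀) hroot hu1 o b))

/-- **`(i)` for `a₃` pendant at a root-only vertex.** -/
theorem zSplitI_of_leaf_rootsOnly (p : E → R) (hp : IsProbVec p) (hl : IsLeafAt ends u a₃ e₀)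
    (ho : o ≠ a₃) (h1 : a₁ ≠ a₃) (h2 : a₂ ≠ a₃) (hb : b ≠ a₃)
    (hroot : ∀ e : {e : E // e ≠ e₀}, u ∈ restrictEnds ends e₀ e →
      restrictEnds ends e₀ e = s(a₁, u) ∨ restrictEnds ends e₀ e = s(a₂, u)) (hu1 : a₁ ≠ u)
    (hub : b ≠ u) : ZSplitI p ends o a₁ a₂ a₃ b :=
  zSplitI_of_leaf_at p hp hl o a₁ a₂ b ho h1 h2 hb
    (zSplitI_of_restrict p hl ho h1 h2 hl.ne hb
      (zSplitI_of_rootsOnly (restrictW p e₀) (IsProbVec.restrictW hp e₀) hroot hu1 o hub))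
    (zSplitIQ_of_restrict p hl ho h1 h2 hl.ne hb
      (zSplitIQ_of_rootsOnly (restrictW p e₀) (IsProbVec.restrictW hp e₀) hroot hu1 o hub))

/-- **`(J1₁)` for `a₃` pendant at a root-only vertex.** -/
theorem jOneOne_of_leaf_rootsOnly (p : E → R) (hp : IsProbVec p) (hl : IsLeafAt ends u a₃ e₀)
    (ho : o ≠ a₃) (h1 : a₁ ≠ a₃) (h2 : a₂ ≠ a₃) (hb : b ≠ a₃)
    (hroot : ∀ e : {e : E // e ≠ e₀}, u ∈ restrictEnds ends e₀ e →
      restrictEnds ends e₀ e = s(a₁, u) ∨ restrictEnds ends e₀ e = s(a₂, u)) (hu1 : a₁ ≠ u)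
    (hub : b ≠ u) : JOneOne p ends o a₁ a₂ a₃ b :=
  jOneOne_of_i_of_ii p ends o a₁ a₂ a₃ b
    (zSplitI_of_leaf_rootsOnly p hp hl ho h1 h2 hb hroot hu1 hub)
    (zSplitII_of_leaf_rootsOnly p hp hl ho h1 h2 hb hroot hu1)

variable {eo : {e : E // e ≠ e₀}}

/-- **`(ii)` for `a₃` pendant at a roots-and-`o` vertex**: in `G − e₀`, `u` has the edge
`eo = {o, u}` and every other edge at `u` joins a root. -/
theorem zSplitII_of_leaf_rootsAndO (p : E → R) (hp : IsProbVec p) (hl : IsLeafAt ends u a₃ e₀)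
    (ho : o ≠ a₃) (h1 : a₁ ≠ a₃) (h2 : a₂ ≠ a₃) (hb : b ≠ a₃)
    (heo : restrictEnds ends e₀ eo = s(o, u))
    (hroot : ∀ e : {e : E // e ≠ e₀}, u ∈ restrictEnds ends e₀ e → e ≠ eo →
      restrictEnds ends e₀ e = s(a₁, u) ∨ restrictEnds ends e₀ e = s(a₂, u))
    (hou : o ≠ u) (hu1 : a₁ ≠ u) (hu2 : a₂ ≠ u) (hub : b ≠ u) : ZSplitII p ends o a₁ a₂ a₃ b :=
  zSplitII_of_leaf_at p hp hl o a₁ a₂ b ho h1 h2 hb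
    (zSplitII_of_restrict p hl ho h1 h2 hl.ne hb
      (zSplitII_of_rootsAndO (restrictW p e₀) (IsProbVec.restrictW hp e₀) heo hroot hou hu1 hu2
        hub))
    (zSplitIIQ_of_restrict p hl ho h1 h2 hl.ne hb
      (zSplitIIQ_of_rootsAndO (restrictW p e₀) (IsProbVec.restrictW hp e₀) heo hroot hou hu1 b))

/-- **`(i)` for `a₃` pendant at a roots-and-`o` vertex.** -/
theorem zSplitI_of_leaf_rootsAndO (p : E → R) (hp : IsProbVec p) (hl : IsLeafAt ends u a₃ e₀)
    (ho : o ≠ a₃) (h1 : a₁ ≠ a₃) (h2 : a₂ ≠ a₃) (hb : b ≠ a₃)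
    (heo : restrictEnds ends e₀ eo = s(o, u))
    (hroot : ∀ e : {e : E // e ≠ e₀}, u ∈ restrictEnds ends e₀ e → e ≠ eo →
      restrictEnds ends e₀ e = s(a₁, u) ∨ restrictEnds ends e₀ e = s(a₂, u))
    (hou : o ≠ u) (hu1 : a₁ ≠ u) (hub : b ≠ u) : ZSplitI p ends o a₁ a₂ a₃ b :=
  zSplitI_of_leaf_at p hp hl o a₁ a₂ b ho h1 h2 hb
    (zSplitI_of_restrict p hl ho h1 h2 hl.ne hb
      (zSplitI_of_rootsAndO (restrictW p e₀) (IsProbVec.restrictW hp e₀) heo hroot hou hu1 hub))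
    (zSplitIQ_of_restrict p hl ho h1 h2 hl.ne hb
      (zSplitIQ_of_rootsAndO (restrictW p e₀) (IsProbVec.restrictW hp e₀) heo hroot hou hu1 hub))

/-- **`(J1₁)` for `a₃` pendant at a roots-and-`o` vertex.** -/
theorem jOneOne_of_leaf_rootsAndO (p : E → R) (hp : IsProbVec p) (hl : IsLeafAt ends u a₃ e₀)
    (ho : o ≠ a₃) (h1 : a₁ ≠ a₃) (h2 : a₂ ≠ a₃) (hb : b ≠ a₃)
    (heo : restrictEnds ends e₀ eo = s(o, u))
    (hroot : ∀ e : {e : E // e ≠ e₀}, u ∈ restrictEnds ends e₀ e → e ≠ eo →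
      restrictEnds ends e₀ e = s(a₁, u) ∨ restrictEnds ends e₀ e = s(a₂, u))
    (hou : o ≠ u) (hu1 : a₁ ≠ u) (hu2 : a₂ ≠ u) (hub : b ≠ u) : JOneOne p ends o a₁ a₂ a₃ b :=
  jOneOne_of_i_of_ii p ends o a₁ a₂ a₃ b
    (zSplitI_of_leaf_rootsAndO p hp hl ho h1 h2 hb heo hroot hou hu1 hub)
    (zSplitII_of_leaf_rootsAndO p hp hl ho h1 h2 hb heo hroot hou hu1 hu2 hub)

end Pendant

end CaseOne

end Summit.Ventures.PercRepro2
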